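import Literature.MathematicalPhysics.QuantumFieldTheory.Balaban1983to89.B5Prop11Fiber
import HarnessLib

/-!
# Route `UnitScaleTilt`, crux K1 «MinimiserStabilityRegPr» (stmt-QuantumFields-19200), EX row `hGF` — the SMALL-MEMBER branch of the curved target `hT`, exit (α)(a) brick (2a) —
# **JOINT `2π` RE-CENTRING OF A TWISTED MOMENTUM INTO THE BRILLOUIN ZONE: the fibre letters of lit `B5Prop11Fiber` at a shifted real momentum `s′` equal the same letters at a
# re-centred `s″`, `|s″_μ| ≤ π`, with the coset offset index translated `k ↦ k + c`**

Cell `ym3-torus` (HUMAN RULING D-0037: YM₃ on T³ is ladder rung R3 — NOT d = 4, NOT infinite volume, NOT a mass gap, NOT Clay).  Width seat `ym3-torus-px10` (gen 10); ★★OWNER WORD 82 (i)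
«type (2a) next».  THEOREMS ONLY (0 `def`, 0 `sorry`); `--supports stmt-QuantumFields-19200 --as helper`, count-neutral.  HONEST LABEL (★★OWNER RULING №33 (6)): real∕modular arithmetic on the
symbols of [Balaban1984PropagatorsI] (1.31)∕(1.61); nothing of the twisted coercivity (D1 + P1–P3 of LOCATE-(α)(a)-2), of `hT`, `hGF`, EX or the crux is proved here.

WHY.  Brick (1) ✓`ToronTwistedMultipliers.twistedSym_emb` reads the twisted forward-difference symbol on the coset `p = p′ + l` as the FLAT symbol lit `B5Prop11Fiber.dSym n k s′` at the shifted
real momentum `s′ = sOf M q + n•φ`; but lit `B5Prop11Fiber.balabanFiber n hn a ha s hs hs0` — the packaged fibre with all the bounds of (1.83)∕(1.89) — is only constructible for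
`hs : ∀ μ, |s μ| ≤ π`.  All fibre letters are `2π`-PERIODIC JOINTLY in `(s_μ, k_μ)`: `dSym n k s μ = n(e^{i(s_μ + 2πk_μ)∕n} − 1)` depends on `s_μ + 2πk_μ (mod 2πn)` and `d1Sym s μ = e^{is_μ} − 1`
on `s_μ (mod 2π)`; so shifting `s_μ` by `−2πj_μ` into `(−π, π]` and the offset by `k_μ ↦ k_μ + j_μ (mod n)` changes nothing.  This file proves exactly that, with the translation
`c` INDEPENDENT of `k` (so `k ↦ k + c` is a bijection of the block index `Fin d → Fin n`, `Equiv.addRight c`, and lit ✓`B5Prop11Plancherel.opNorm_reindex` moves block bounds across).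

WHAT IS PROVED (ns `…Theorems.ToronTwistedRecentring`; any `d`, any `n ≥ 1`).
* §1 `d1Sym_eq_of_eq_add_int_mul` (`s″_μ = s′_μ + 2πt` ⟹ `d1Sym s″ μ = d1Sym s′ μ`), `dSym_eq_of_shiftr_eq_add_int_mul` (`shiftr n k″ s″ μ = shiftr n k s′ μ + 2πn·t` ⟹ `dSym` equal),
  `vSym_eq_of_eq` ∕ `uSym_eq_of_eq` ∕ `DeltaXir_shiftr_eq_of_eq` (the derived letters follow the two basic ones).
* §2 ★★★ `exists_recentre (n) (s′) : ∃ (c : Fin d → Fin n) (s″ : Fin d → ℝ), (∀ μ, |s″ μ| ≤ π) ∧ ∀ k μ, d1Sym s″ μ = d1Sym s′ μ ∧ dSym n (k + c) s″ μ = dSym n k s′ μ`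
  (`s″_μ := toIocMod 2π (−π) s′_μ`, `c_μ := (toIocDiv … mod n)`), and ★★ `exists_recentre_fiberLetters` (the same `c, s″` transport `vSym`, `uSym` and `DeltaXir n 0 (shiftr …)` for every `k`).
HONEST SCOPE.  Periodicity bookkeeping; the case `s″ = 0` (the coset carrying the constant mode at a toron) is NOT excluded here — the consumer splits on it as the flat engine does on `q = 0`.

References: T. Bałaban, CMP **95** (1984) 17–40 [Balaban1984PropagatorsI] ((1.31) p.23, (1.61) p.28, (1.83) p.31); CMP **99** (1985) 389–434 [Balaban1985BackgroundPropagators] (Thm 3.11 p.416).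
-/

set_option autoImplicit false

noncomputable section

open scoped BigOperators
open Complex (I)

namespace Summit.QuantumFields.YangMills.Theorems.ToronTwistedRecentring

open Literature.MathematicalPhysics.QuantumFieldTheory.Balaban1983to89.B5Prop11Fiber (dSym d1Sym vSym uSym Delta_eq)
open Literature.MathematicalPhysics.QuantumFieldTheory.Balaban1983to89.B4Strip (shiftr DeltaXir)

variable {d : ℕ}

/-! ## §1 Periodicity of the two basic symbols and of the derived letters -/

/-- `e^{i(x + 2πt)} = e^{ix}` for an integer `t`. [folklore] -/
theorem exp_mul_I_add_int_mul_two_pi (x : ℝ) (t : ℤ) :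
    Complex.exp (((x + 2 * Real.pi * (t : ℝ) : ℝ) : ℂ) * I) = Complex.exp (((x : ℝ) : ℂ) * I) := by
  have h : (((x + 2 * Real.pi * (t : ℝ) : ℝ) : ℂ) * I) = ((x : ℝ) : ℂ) * I + (t : ℂ) * (2 * Real.pi * I) := by
    push_cast; ring
  rw [h, Complex.exp_add, Complex.exp_int_mul_two_pi_mul_I, mul_one]

/-- `∂¹_μ` is `2π`-periodic in `p′_μ`: `s″_μ = s′_μ + 2πt` ⟹ `d1Sym s″ μ = d1Sym s′ μ`. [cite: Balaban1984PropagatorsI, (1.31) p.23] -/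
theorem d1Sym_eq_of_eq_add_int_mul {s' s'' : Fin d → ℝ} {μ : Fin d} (t : ℤ) (h : s'' μ = s' μ + 2 * Real.pi * (t : ℝ)) :
    d1Sym s'' μ = d1Sym s' μ := by
  unfold d1Sym
  rw [h, exp_mul_I_add_int_mul_two_pi]

/-- `∂_μ(p′ + l)` depends on `p′_μ + l_μ` modulo `2πn` only: `shiftr n k″ s″ μ = shiftr n k s′ μ + 2πn·t` ⟹ `dSym n k″ s″ μ = dSym n k s′ μ`. [cite: Balaban1984PropagatorsI, (1.31) p.23] -/
theorem dSym_eq_of_shiftr_eq_add_int_mul {n : ℕ} (hn : 1 ≤ n) {k k'' : Fin d → Fin n} {s' s'' : Fin d → ℝ} {μ : Fin d} (t : ℤ)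
    (h : shiftr n k'' s'' μ = shiftr n k s' μ + 2 * Real.pi * (n : ℝ) * (t : ℝ)) :
    dSym n k'' s'' μ = dSym n k s' μ := by
  have hn0 : (n : ℝ) ≠ 0 := by exact_mod_cast (by omega : n ≠ 0)
  have hdiv : shiftr n k'' s'' μ / n = shiftr n k s' μ / n + 2 * Real.pi * (t : ℝ) := by
    rw [h]; field_simp
  unfold dSym
  rw [hdiv, exp_mul_I_add_int_mul_two_pi]

/-- `v_μ` follows the two basic symbols. [cite: Balaban1984PropagatorsI, (1.61) p.28] -/
theorem vSym_eq_of_eq {n : ℕ} {k k'' : Fin d → Fin n} {s' s'' : Fin d → ℝ} {μ : Fin d}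
    (h1 : d1Sym s'' μ = d1Sym s' μ) (h2 : dSym n k'' s'' μ = dSym n k s' μ) :
    vSym n k'' s'' μ = vSym n k s' μ := by
  unfold vSym
  rw [h1, h2]

/-- `u = Π_μ v_μ` follows. [cite: Balaban1984PropagatorsI, (1.31) p.23] -/
theorem uSym_eq_of_eq {n : ℕ} {k k'' : Fin d → Fin n} {s' s'' : Fin d → ℝ}
    (h1 : ∀ μ, d1Sym s'' μ = d1Sym s' μ) (h2 : ∀ μ, dSym n k'' s'' μ = dSym n k s' μ) :
    uSym n k'' s'' = uSym n k s' := by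
  unfold uSym
  exact Finset.prod_congr rfl fun μ _ => vSym_eq_of_eq (h1 μ) (h2 μ)

/-- `Δ(p′ + l) = Σ_μ |∂_μ(p′ + l)|²` follows (lit ✓`Delta_eq`). [cite: Balaban1984PropagatorsI, (1.31) p.23] -/
theorem DeltaXir_shiftr_eq_of_eq {n : ℕ} {k k'' : Fin d → Fin n} {s' s'' : Fin d → ℝ}
    (h2 : ∀ μ, dSym n k'' s'' μ = dSym n k s' μ) :
    DeltaXir n 0 (shiftr n k'' s'') = DeltaXir n 0 (shiftr n k s') := by
  rw [Delta_eq, Delta_eq]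
  exact Finset.sum_congr rfl fun μ _ => by rw [h2 μ]

/-! ## §2 ★★★ The re-centring -/

/-- the coset-offset translation `c_μ := (j_μ mod n)` read in `Fin n`, for an integer vector `j`. [folklore] -/
theorem val_offset_lt {n : ℕ} (hn : 1 ≤ n) (j : ℤ) : ((j % (n : ℤ)).toNat) < n := by
  have hn' : (0 : ℤ) < n := by exact_mod_cast (by omega : 0 < n)
  have h1 : j % (n : ℤ) < n := Int.emod_lt_of_pos j hn'
  have h0 : 0 ≤ j % (n : ℤ) := Int.emod_nonneg j hn'.ne'
  omega

/-- ★★★ **JOINT `2π` RE-CENTRING.**  For every `n ≥ 1` and every real momentum `s′` there are a translation `c : Fin d → Fin n` of the coset offsets and a re-centred momentum `s″` with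
`|s″_μ| ≤ π` such that for EVERY offset `k` and direction `μ`: `∂¹_μ(s″) = ∂¹_μ(s′)` and `∂_μ(s″ + 2π(k + c)) = ∂_μ(s′ + 2πk)` — i.e. the flat fibre letters of (1.31)∕(1.83) at the shifted
momentum of a toron (✓`ToronTwistedMultipliers.twistedSym_emb`) ARE fibre letters inside the Brillouin zone, block index translated by `c` (a bijection, `Equiv.addRight c`).
(`s″_μ = toIocMod 2π (−π) s′_μ ∈ (−π, π]`, `c_μ = toIocDiv 2π (−π) s′_μ mod n`.) [cite: Balaban1984PropagatorsI, (1.31) p.23, (1.83) p.31] -/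
theorem exists_recentre {n : ℕ} (hn : 1 ≤ n) (s' : Fin d → ℝ) :
    ∃ (c : Fin d → Fin n) (s'' : Fin d → ℝ), (∀ μ, |s'' μ| ≤ Real.pi) ∧
      ∀ (k : Fin d → Fin n) (μ : Fin d), d1Sym s'' μ = d1Sym s' μ ∧ dSym n (k + c) s'' μ = dSym n k s' μ := by
  have h2π : (0 : ℝ) < 2 * Real.pi := Real.two_pi_pos
  have hn' : (0 : ℤ) < n := by exact_mod_cast (by omega : 0 < n)
  -- the re-centred momentum `s″_μ = toIocMod 2π (−π) s′_μ = s′_μ − j_μ·2π`, `j_μ = toIocDiv 2π (−π) s′_μ`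
  have hs''eq : ∀ μ, toIocMod h2π (-Real.pi) (s' μ) = s' μ + 2 * Real.pi * ((-toIocDiv h2π (-Real.pi) (s' μ) : ℤ) : ℝ) := by
    intro μ
    rw [← self_sub_toIocDiv_zsmul h2π (-Real.pi) (s' μ), zsmul_eq_mul]
    push_cast; ring
  -- the offsets `c_μ = j_μ mod n`, read in `Fin n`
  have hcval : ∀ μ, (((⟨((toIocDiv h2π (-Real.pi) (s' μ)) % (n : ℤ)).toNat, val_offset_lt hn _⟩ : Fin n) : ℕ) : ℤ)
      = (toIocDiv h2π (-Real.pi) (s' μ)) % (n : ℤ) := fun μ => Int.toNat_of_nonneg (Int.emod_nonneg _ hn'.ne')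
  refine ⟨fun μ => ⟨((toIocDiv h2π (-Real.pi) (s' μ)) % (n : ℤ)).toNat, val_offset_lt hn _⟩, fun μ => toIocMod h2π (-Real.pi) (s' μ),
    fun μ => ?_, fun k μ => ⟨d1Sym_eq_of_eq_add_int_mul (-toIocDiv h2π (-Real.pi) (s' μ)) (hs''eq μ), ?_⟩⟩
  · -- `|s″_μ| ≤ π`
    have hmem := toIocMod_mem_Ioc h2π (-Real.pi) (s' μ)
    rw [Set.mem_Ioc] at hmem
    rw [abs_le]
    constructor <;> linarith [hmem.1, hmem.2]
  · -- `shiftr n (k + c) s″ μ = shiftr n k s′ μ + 2πn·t` with an integer `t`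
    set j : ℤ := toIocDiv h2π (-Real.pi) (s' μ) with hj
    set cμ : Fin n := ⟨(j % (n : ℤ)).toNat, val_offset_lt hn j⟩ with hcμ
    have hcμval : ((cμ : ℕ) : ℤ) = j % (n : ℤ) := hcval μ
    -- (i) `(k + c)_μ.val ≡ k_μ.val + j (mod n)`
    have hmod : (n : ℤ) ∣ ((((k μ + cμ : Fin n) : ℕ) : ℤ) - ((k μ : ℕ) : ℤ) - j) := by
      have hval : (((k μ + cμ : Fin n) : ℕ) : ℤ) = ((((k μ : ℕ) + (cμ : ℕ)) % n : ℕ) : ℤ) := by rw [Fin.val_add]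
      rw [hval, Int.natCast_mod, Nat.cast_add, hcμval]
      have h1 : (n : ℤ) ∣ (((k μ : ℕ) : ℤ) + j % (n : ℤ)) % (n : ℤ) - (((k μ : ℕ) : ℤ) + j % (n : ℤ)) :=
        ⟨-((((k μ : ℕ) : ℤ) + j % (n : ℤ)) / (n : ℤ)), by rw [Int.emod_def]; ring⟩
      have h2 : (n : ℤ) ∣ (j % (n : ℤ) - j) := ⟨-(j / (n : ℤ)), by rw [Int.emod_def]; ring⟩
      have h3 := dvd_add h1 h2
      have e : (((k μ : ℕ) : ℤ) + j % (n : ℤ)) % (n : ℤ) - (((k μ : ℕ) : ℤ) + j % (n : ℤ)) + (j % (n : ℤ) - j)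
          = (((k μ : ℕ) : ℤ) + j % (n : ℤ)) % (n : ℤ) - ((k μ : ℕ) : ℤ) - j := by ring
      rwa [e] at h3
    obtain ⟨t, ht⟩ := hmod
    refine dSym_eq_of_shiftr_eq_add_int_mul hn t ?_
    -- (ii) the real identity
    have htR : (((k μ + cμ : Fin n) : ℕ) : ℝ) - ((k μ : ℕ) : ℝ) - (j : ℝ) = (n : ℝ) * (t : ℝ) := by exact_mod_cast ht
    have hadd : (k + fun μ => (⟨((toIocDiv h2π (-Real.pi) (s' μ)) % (n : ℤ)).toNat, val_offset_lt hn _⟩ : Fin n)) μ = k μ + cμ := rfl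
    unfold shiftr
    beta_reduce
    rw [hadd, hs''eq μ]
    push_cast
    linear_combination (2 * Real.pi) * htR

/-- ★★ **THE SAME `c, s″` TRANSPORT ALL THE DERIVED FIBRE LETTERS** (`v_μ`, `u`, `Δ(p′+l)`): for every offset `k`,
`vSym n (k + c) s″ μ = vSym n k s′ μ`, `uSym n (k + c) s″ = uSym n k s′`, `DeltaXir n 0 (shiftr n (k + c) s″) = DeltaXir n 0 (shiftr n k s′)`. [cite: Balaban1984PropagatorsI, (1.31) p.23, (1.61) p.28] -/
theorem exists_recentre_fiberLetters {n : ℕ} (hn : 1 ≤ n) (s' : Fin d → ℝ) :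
    ∃ (c : Fin d → Fin n) (s'' : Fin d → ℝ), (∀ μ, |s'' μ| ≤ Real.pi) ∧
      ∀ (k : Fin d → Fin n),
        (∀ μ, d1Sym s'' μ = d1Sym s' μ) ∧ (∀ μ, dSym n (k + c) s'' μ = dSym n k s' μ) ∧
        (∀ μ, vSym n (k + c) s'' μ = vSym n k s' μ) ∧ uSym n (k + c) s'' = uSym n k s' ∧
        DeltaXir n 0 (shiftr n (k + c) s'') = DeltaXir n 0 (shiftr n k s') := by
  obtain ⟨c, s'', habs, h⟩ := exists_recentre hn s'
  refine ⟨c, s'', habs, fun k => ?_⟩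
  have h1 : ∀ μ, d1Sym s'' μ = d1Sym s' μ := fun μ => (h k μ).1
  have h2 : ∀ μ, dSym n (k + c) s'' μ = dSym n k s' μ := fun μ => (h k μ).2
  exact ⟨h1, h2, fun μ => vSym_eq_of_eq (h1 μ) (h2 μ), uSym_eq_of_eq h1 h2, DeltaXir_shiftr_eq_of_eq h2⟩

end Summit.QuantumFields.YangMills.Theorems.ToronTwistedRecentring

end
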